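import Summits.MatrixMultiplication.MatrixMultiplication.Theorems.ObstructionDescentUniversalOccurrenceTwoRectangleThreeThreeOneValue

set_option linter.dupNamespace false
set_option autoImplicit false

/-!
# Universal occurrence — two rectangles and the shape `(2N-7,3,3,1)`, part C₃: positions and the witness word (decomp-mm · lens 3 · gen 46)

Route `route-MatrixMultiplication-ObstructionDescent` (sub-problem `MatrixMultiplication`, `ω(ℂ) = 2`); SUPPORT for the crux
`NoOccurrenceObstruction` (`P_O`, item `stmt-MatrixMultiplication-29040`).  Nothing here proves `ω = 2` or closes an item;
no `def`, no `sorry`, standard axioms.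

Arithmetic of the design `D″(N)` on positions `q < 2N` (block `q % 2`, slot `q / 2`), all in `ℕ` and in hypothesis form
(each intermediate value is a variable with its defining equation): the double cross `κ = (0 1)(6 7)` and the block flip
`β : q ↦ q ± 1` are commuting involutions, `β` flips the block, and `κβ` is the column involution `(2 3)(4 5)(8 9)` of the
tableau `T″` times the flip of the arm dominoes (`threeThreeOne_kappa_beta`, the hypothesis of
`threeThreeOneTableau_comp_flip`); and the values of the three legs of the witness word
`ι_w = (N+1, N, 0, 1, 2, 3, 4, 4, 3, 2, 5, 5, 6, 6, …)` of the main file: first leg `(1, 0, 0, 1, 2, 3, 4, 4, 3, 2, 5, 5, …)`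
(a bijection on each block, equal to the twisted second leg), third leg `(2, 3, 0, 1, 2, 1, 0, 0, 1, 2, 0, 0, …)` (injective
on the columns of `T″`, zero on the arm).

[cite: BurgisserIkenmeyer2011, Thm. 4.4, Lemma 6.1] [cite: BurgisserIkenmeyer2017, §5, Thm. 5.9 (proof of (2)), eq. (3.4)]
-/

namespace Summit.MatrixMultiplication.MatrixMultiplication.Theorems.ObstructionCalculus

/-! ### The double cross `κ = (0 1)(6 7)`, the block flip `β` and `π = κβ` on positions (values in `ℕ`) -/

/-- `κ` is an involution. [this node] -/
theorem threeThreeOne_kappa_kappa {q k r : ℕ} (hk : k = (if q = 0 then 1 else if q = 1 then 0 else if q = 6 then 7 else if q = 7 then 6 else q))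
    (hr : r = (if k = 0 then 1 else if k = 1 then 0 else if k = 6 then 7 else if k = 7 then 6 else k)) : r = q := by
  split_ifs at hk hr <;> omega

/-- `β` is an involution. [this node] -/
theorem threeThreeOne_beta_beta {q b r : ℕ} (hb : b = (if q % 2 = 0 then q + 1 else q - 1))
    (hr : r = (if b % 2 = 0 then b + 1 else b - 1)) : r = q := by
  split_ifs at hb hr <;> omega

/-- `β` flips the block. [this node] -/
theorem threeThreeOne_beta_block {q b : ℕ} (hb : b = (if q % 2 = 0 then q + 1 else q - 1)) : b % 2 + q % 2 = 1 := by
  split_ifs at hb <;> omega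

set_option maxHeartbeats 800000 in
/-- The values of `π = κβ`: the column involution `(2 3)(4 5)(8 9)` of the tableau `T″` times the flip of the arm dominoes.
[this node] -/
theorem threeThreeOne_kappa_beta {q b k : ℕ} (hb : b = (if q % 2 = 0 then q + 1 else q - 1))
    (hk : k = (if b = 0 then 1 else if b = 1 then 0 else if b = 6 then 7 else if b = 7 then 6 else b)) :
    k = (if q = 2 then 3 else if q = 3 then 2 else if q = 4 then 5 else if q = 5 then 4 else if q = 8 then 9
      else if q = 9 then 8 else if q < 10 then q else if q % 2 = 0 then q + 1 else q - 1) := by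
  split_ifs at hb hk ⊢ <;> omega

set_option maxHeartbeats 800000 in
/-- `κ` and `β` commute (both are products of transpositions `(2s, 2s+1)`). [this node] -/
theorem threeThreeOne_kappa_beta_comm {q b k k' b' : ℕ} (hb : b = (if q % 2 = 0 then q + 1 else q - 1))
    (hk : k = (if b = 0 then 1 else if b = 1 then 0 else if b = 6 then 7 else if b = 7 then 6 else b))
    (hk' : k' = (if q = 0 then 1 else if q = 1 then 0 else if q = 6 then 7 else if q = 7 then 6 else q))
    (hb' : b' = (if k' % 2 = 0 then k' + 1 else k' - 1)) : k = b' := by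
  split_ifs at hk' hb hk hb' <;> omega

/-! ### The witness word (values in `ℕ`) -/

/-- Witness: first-leg values. [this node] -/
theorem threeThreeOneWitness_fst {N q v : ℕ} (hN : 5 ≤ N) (hq : q < N * 2)
    (hv : v = (if q = 0 then N + 1 else if q = 1 then N else if q < 7 then q - 2 else if q < 10 then 11 - q else q / 2)) :
    (if v < N then v else v - N) = (if q = 0 then 1 else if q = 1 then 0 else if q < 7 then q - 2 else if q < 10 then 11 - q else q / 2) := by
  split_ifs at hv ⊢ <;> omega

set_option maxHeartbeats 800000 in
/-- Witness: the twisted second leg agrees with the first leg. [this node] -/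
theorem threeThreeOneWitness_snd {N q k v : ℕ} (hN : 5 ≤ N) (hq : q < N * 2)
    (hk : k = (if q = 0 then 1 else if q = 1 then 0 else if q = 6 then 7 else if q = 7 then 6 else q))
    (hv : v = (if k = 0 then N + 1 else if k = 1 then N else if k < 7 then k - 2 else if k < 10 then 11 - k else k / 2)) :
    (if v < N then v else N + 1 - v) = (if q = 0 then 1 else if q = 1 then 0 else if q < 7 then q - 2 else if q < 10 then 11 - q else q / 2) := by
  split_ifs at hk hv ⊢ <;> omega

set_option maxHeartbeats 800000 in
/-- Witness: third-leg values. [this node] -/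
theorem threeThreeOneWitness_third {N q v : ℕ} (hN : 5 ≤ N) (hq : q < N * 2)
    (hv : v = (if q = 0 then N + 1 else if q = 1 then N else if q < 7 then q - 2 else if q < 10 then 11 - q else q / 2)) :
    (if v = 1 then 1 else if v = 2 then 2 else if v = 3 then 1 else if v = N then 3 else if v = N + 1 then 2 else 0) =
      (if q = 0 then 2 else if q = 1 then 3 else if q = 2 then 0 else if q = 3 then 1 else if q = 4 then 2
      else if q = 5 then 1 else if q = 8 then 1 else if q = 9 then 2 else 0) := by
  split_ifs at hv ⊢ <;> omega

/-- Witness: block `0` of the first-leg word. [this node] -/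
theorem threeThreeOneWitness_block0 {s : ℕ} :
    (if (0 + 2 * s) = 0 then 1 else if (0 + 2 * s) = 1 then 0 else if (0 + 2 * s) < 7 then (0 + 2 * s) - 2 else if (0 + 2 * s) < 10 then 11 - (0 + 2 * s) else (0 + 2 * s) / 2) =
      (if s = 0 then 1 else if s = 1 then 0 else if s = 3 then 4 else if s = 4 then 3 else s) := by
  split_ifs <;> omega

/-- Witness: block `1` of the first-leg word. [this node] -/
theorem threeThreeOneWitness_block1 {s : ℕ} :
    (if (1 + 2 * s) = 0 then 1 else if (1 + 2 * s) = 1 then 0 else if (1 + 2 * s) < 7 then (1 + 2 * s) - 2 else if (1 + 2 * s) < 10 then 11 - (1 + 2 * s) else (1 + 2 * s) / 2) =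
      (if s = 2 then 3 else if s = 3 then 4 else if s = 4 then 2 else s) := by
  split_ifs <;> omega

/-- Witness: block `0` of the first-leg word is injective. [this node] -/
theorem threeThreeOneWitness_block0_inj {s s' : ℕ}
    (h : (if s = 0 then 1 else if s = 1 then 0 else if s = 3 then 4 else if s = 4 then 3 else s) = (if s' = 0 then 1 else if s' = 1 then 0 else if s' = 3 then 4 else if s' = 4 then 3 else s')) : s = s' := by
  split_ifs at h <;> omega

/-- Witness: block `1` of the first-leg word is injective. [this node] -/
theorem threeThreeOneWitness_block1_inj {s s' : ℕ}
    (h : (if s = 2 then 3 else if s = 3 then 4 else if s = 4 then 2 else s) = (if s' = 2 then 3 else if s' = 3 then 4 else if s' = 4 then 2 else s')) : s = s' := by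
  split_ifs at h <;> omega

/-- Witness: the third-leg word is injective on each column. [this node] -/
theorem threeThreeOneWitness_third_inj {q q' : ℕ}
    (hcol : ((q < 4 ∧ q' < 4) ∨ (4 ≤ q ∧ q < 7 ∧ 4 ≤ q' ∧ q' < 7) ∨ (7 ≤ q ∧ q < 10 ∧ 7 ≤ q' ∧ q' < 10)))
    (h : (if q = 0 then 2 else if q = 1 then 3 else if q = 2 then 0 else if q = 3 then 1 else if q = 4 then 2
      else if q = 5 then 1 else if q = 8 then 1 else if q = 9 then 2 else 0) =
      (if q' = 0 then 2 else if q' = 1 then 3 else if q' = 2 then 0 else if q' = 3 then 1 else if q' = 4 then 2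
      else if q' = 5 then 1 else if q' = 8 then 1 else if q' = 9 then 2 else 0)) : q = q' := by
  have hq : q < 10 := by omega
  have hq' : q' < 10 := by omega
  have key : ∀ a b : Fin 10, (((a : ℕ) < 4 ∧ (b : ℕ) < 4) ∨ (4 ≤ (a : ℕ) ∧ (a : ℕ) < 7 ∧ 4 ≤ (b : ℕ) ∧ (b : ℕ) < 7) ∨ (7 ≤ (a : ℕ) ∧ (a : ℕ) < 10 ∧ 7 ≤ (b : ℕ) ∧ (b : ℕ) < 10)) →
      (if (a : ℕ) = 0 then 2 else if (a : ℕ) = 1 then 3 else if (a : ℕ) = 2 then 0 else if (a : ℕ) = 3 then 1 else if (a : ℕ) = 4 then 2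
      else if (a : ℕ) = 5 then 1 else if (a : ℕ) = 8 then 1 else if (a : ℕ) = 9 then 2 else 0) =
        (if (b : ℕ) = 0 then 2 else if (b : ℕ) = 1 then 3 else if (b : ℕ) = 2 then 0 else if (b : ℕ) = 3 then 1 else if (b : ℕ) = 4 then 2
      else if (b : ℕ) = 5 then 1 else if (b : ℕ) = 8 then 1 else if (b : ℕ) = 9 then 2 else 0) → (a : ℕ) = (b : ℕ) := by
    decide
  exact key ⟨q, hq⟩ ⟨q', hq'⟩ hcol h

end Summit.MatrixMultiplication.MatrixMultiplication.Theorems.ObstructionCalculus
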